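import Literature.NumberTheory.LFunctions.ZetaZeroSumsPsiErrorNumericalInputs
import Literature.NumberTheory.LFunctions.ZetaZeroCountBellottiWong
import Literature.NumberTheory.LFunctions.ZetaZeroFreeRegionBellottiTrudgianYang
import HarnessLib

/-!
# RH-FREE — Fiori–Kadiri–Swidinsky's `|ψ(x) − x|` formula (4.1) with the 2025–2026 inputs: the Bellotti–Trudgian–Yang zero-free region and the Bellotti–Wong `N(T)` bound («nothing here bears on the truth of RH»)

Topic `Literature/NumberTheory/LFunctions` (RH literature-typing tranche 1, L4 "explicit zero
statistics", gen 9). THEOREMS only (no definitions, no new named facts). The tree's kernel theorem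
`FioriKadiriSwidinsky2023_eq41'` (`ZetaZeroSumsPsiErrorAssembly.lean`: FKS 2023 §4 eq. (4.1) at the
point `x`, generic in the classical zero-free-region constant `R`, in the `N(T)`-error triple
`(b₁, b₂, b₃)` and in the zero-density family) is instantiated with the two new typed inputs of
this tranche:

* the zero-free region: any `R > 4.896`, from the CLAIMED Theorem 1 of Bellotti–Trudgian–Yang 2026
  (`zero_free_region_bellotti_trudgian_yang`, preprint, via `.zeroFree`) — in place of `5.558691`
  (Mossinghoff–Trudgian–Yang 2024, the instance `FioriKadiriSwidinsky2023_eq41_of_numerical_rh`) or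
  FKS's own `5.5666305`;
* the `N(T)` error: `(b₁, b₂, b₃) = (0.11200, 0.12567, 3.77417 + 7/8)` from the second bound of
  Bellotti–Wong's Theorem 1.1 (`BellottiWong2025_thm11`, Math. Comp. to appear), extended here to
  the whole range `t ≥ 2` required by `ε₂` (`BellottiWong2025_thm11.abs_count_sub_countMain_le_two'`)
  — in place of FKS's Rosser-1941 triple `(0.137, 0.443, 1.588)` or the tree's fact-free Backlund
  triple `(0.3083, 0, 3.253)`.

Results: `FioriKadiriSwidinsky2023_eq41_of_bty_bw` (generic (ZDB) family on `[σ₁, σ₂]`,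
`5/8 ≤ σ₁`) and `FioriKadiriSwidinsky2023_eq41_explicit_bty_bw` (`0.90 ≤ σ₁ < σ₂ < 1`, the Cor. 2.9
table fact `FioriKadiriSwidinsky2023_table6` as the (ZDB) family). Remaining named inputs, all
explicit hypotheses: `zero_free_region_bellotti_trudgian_yang` (claim), `BellottiWong2025_thm11`,
`CullyHugillJohnston2023_table4'`, `FioriKadiriSwidinsky2023_table2`, `platt_trudgian_numerical_rh`
(+ `FioriKadiriSwidinsky2023_table6` in the explicit form). No numerical value of FKS's Table 5 is
re-derived here (that needs the optimisation over `(σ₁, σ₂, N, K, T)`); nothing here bears on the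
truth of RH.

## References

* A. Fiori, H. Kadiri, J. Swidinsky, J. Math. Anal. Appl. 527 (2023) 127426 = arXiv:2204.02588v3,
  §4 eq. (4.1), Props. 3.4/3.6/3.8/3.11. [FioriKadiriSwidinsky2023]
* C. Bellotti, T. Trudgian, A. Yang, arXiv:2603.21490v1 (2026), Thm. 1. [BellottiTrudgianYang2026]
* C. Bellotti, P.-J. Wong, Math. Comp., to appear (arXiv:2412.15470v2), Thm. 1.1. [BellottiWong2025]
-/

noncomputable section

open Complex Filter Set
open scoped Real Chebyshev

namespace Literature.NumberTheory.LFunctions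

open SchoenfeldBound

/-! ## The Bellotti–Wong `N(T)` error on the whole range `t ≥ 2` -/

namespace BellottiWong2025_thm11

/-- **`|N(t) − L(t)| ≤ 0.11200 log t + 0.12567 log log t + 4.64917` for all `t ≥ 2`** (Theorem 1.1,
second bound, gives it for `t ≥ e`; for `2 ≤ t < e`: `N(t) = 0` (`N(14) = 0`, the tree's certified
first zero), `−1/8 ≤ L(t) ≤ 7/8` and `log log t ≥ 1 − 1/log 2 > −0.45`, so the right-hand side
exceeds `4.5 > 7/8`).
[cite: BellottiWong2025, Thm. 1.1] -/
theorem abs_count_sub_countMain_le_two' (h : BellottiWong2025_thm11) {t : ℝ} (ht : 2 ≤ t) :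
    |(zetaZeroCount t : ℝ) - countMain t| ≤ FKS2023.countErr 0.11200 0.12567 4.64917 t := by
  rcases le_or_gt (Real.exp 1) t with he | he
  · exact h.abs_count_sub_countMain_le_two he
  have he3 : Real.exp 1 < 2.7182818286 := Real.exp_one_lt_d9
  have ht0 : 0 < t := by linarith
  have ht17 : t ≤ 17 := by linarith
  have hN0 : (zetaZeroCount t : ℝ) = 0 := by
    have hm : zetaZeroCount t ≤ zetaZeroCount 14 :=
      zetaZeroCountRe_mono_right_holds 0 (show t ≤ (14 : ℝ) by linarith)
    rw [zetaZeroCount_fourteen] at hm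
    exact_mod_cast Nat.le_zero.1 hm
  have hL1 := SchoenfeldBound.neg_eighth_le_countMain ht0
  have hL2 := SchoenfeldBound.countMain_le_of_le_seventeen ht0 ht17
  have hl2 : 0.6931471803 < Real.log 2 := Real.log_two_gt_d9
  have hlog : Real.log 2 ≤ Real.log t := Real.log_le_log (by norm_num) ht
  have hlog0 : 0 < Real.log t := by linarith
  have hll : -0.45 ≤ Real.log (Real.log t) := by
    have h1 := Real.one_sub_inv_le_log_of_pos hlog0
    have h2 : (Real.log t)⁻¹ ≤ (Real.log 2)⁻¹ := by
      rw [inv_le_inv₀ hlog0 (by linarith)]; exact hlog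
    have h3 : (Real.log 2)⁻¹ ≤ 1.45 := by
      rw [inv_le_comm₀ (by linarith) (by norm_num)]; linarith
    linarith
  unfold FKS2023.countErr
  rw [abs_le]
  constructor <;> nlinarith

/-- The same with the first bound: `|N(t) − L(t)| ≤ 0.10076 log t + 0.24460 log log t + 8.95844`
for all `t ≥ 2`. [cite: BellottiWong2025, Thm. 1.1] -/
theorem abs_count_sub_countMain_le_one' (h : BellottiWong2025_thm11) {t : ℝ} (ht : 2 ≤ t) :
    |(zetaZeroCount t : ℝ) - countMain t| ≤ FKS2023.countErr 0.10076 0.24460 8.95844 t := by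
  rcases le_or_gt (Real.exp 1) t with he | he
  · exact h.abs_count_sub_countMain_le he
  have he3 : Real.exp 1 < 2.7182818286 := Real.exp_one_lt_d9
  have ht0 : 0 < t := by linarith
  have ht17 : t ≤ 17 := by linarith
  have hN0 : (zetaZeroCount t : ℝ) = 0 := by
    have hm : zetaZeroCount t ≤ zetaZeroCount 14 :=
      zetaZeroCountRe_mono_right_holds 0 (show t ≤ (14 : ℝ) by linarith)
    rw [zetaZeroCount_fourteen] at hm
    exact_mod_cast Nat.le_zero.1 hm
  have hL1 := SchoenfeldBound.neg_eighth_le_countMain ht0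
  have hL2 := SchoenfeldBound.countMain_le_of_le_seventeen ht0 ht17
  have hl2 : 0.6931471803 < Real.log 2 := Real.log_two_gt_d9
  have hlog : Real.log 2 ≤ Real.log t := Real.log_le_log (by norm_num) ht
  have hlog0 : 0 < Real.log t := by linarith
  have hll : -0.45 ≤ Real.log (Real.log t) := by
    have h1 := Real.one_sub_inv_le_log_of_pos hlog0
    have h2 : (Real.log t)⁻¹ ≤ (Real.log 2)⁻¹ := by
      rw [inv_le_inv₀ hlog0 (by linarith)]; exact hlog
    have h3 : (Real.log 2)⁻¹ ≤ 1.45 := by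
      rw [inv_le_comm₀ (by linarith) (by norm_num)]; linarith
    linarith
  unfold FKS2023.countErr
  rw [abs_le]
  constructor <;> nlinarith

end BellottiWong2025_thm11

/-! ## FKS (4.1) with the new inputs -/

/-- **FKS (4.1) at `x` with the Bellotti–Trudgian–Yang region and the Bellotti–Wong `N(T)` error.**
For any `R > 4.896`, the zero-free region `σ ≥ 1 − 1/(R log|t|)` (`|t| ≥ 2`) holds by the claimed
Theorem 1 of Bellotti–Trudgian–Yang (`zero_free_region_bellotti_trudgian_yang.zeroFree`); the
`N(T)` error triple is `(0.11200, 0.12567, 4.64917)` (`BellottiWong2025_thm11`, second bound,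
`+ 7/8` for the tree's `countMain`). Everything else as in `FioriKadiriSwidinsky2023_eq41'`:
`|ψ(x) − x| ≤ (ε₁ + ε₂ + ε₃ + ε₄) x` for `x > e^{50}`, `3 log x < T < √x/3`, `T` above the
heights `H^{(n)}` and `t₀(R, σ₂, x)`, a (ZDB) family on `[σ₁, σ₂]` with `5/8 ≤ σ₁ < σ₂ ≤ 1`.
[cite: FioriKadiriSwidinsky2023, §4 eq. (4.1) (proof of Thm. 1.1)]
[claim: BellottiTrudgianYang2026, status: under-review] [cite: BellottiWong2025, Thm. 1.1] -/
theorem FioriKadiriSwidinsky2023_eq41_of_bty_bw (hBTY : zero_free_region_bellotti_trudgian_yang)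
    (hBW : BellottiWong2025_thm11) (hCHJ : CullyHugillJohnston2023_table4')
    (hTab : FioriKadiriSwidinsky2023_table2) (hRH : platt_trudgian_numerical_rh)
    {R : ℝ} (hR : 4.896 < R)
    {T₀ S₀ : ℝ} (hrow : (T₀, S₀) ∈ FKS2023.recipZeroTable2)
    {c₁ c₂ p q : ℝ → ℝ} {σ₁ σ₂ : ℝ} (h58 : 5 / 8 ≤ σ₁) (h12 : σ₁ < σ₂) (hσ₂ : σ₂ ≤ 1)
    (hpq : ∀ σ ∈ Icc σ₁ σ₂, 0 < p σ ∧ p σ < 1 ∧ 0 < q σ)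
    (hZD : ∀ σ ∈ Icc σ₁ σ₂, ∀ T' : ℝ, FKS2023.H₀ ≤ T' →
      (zetaZeroCountRe σ T' : ℝ) ≤ FKS2023.zdbMajorant (c₁ σ) (c₂ σ) (p σ) (q σ) T')
    {N K : ℕ} (hN2 : 2 ≤ N) (hK : 1 ≤ K) {x T : ℝ} (hx : Real.exp 50 < x)
    (hT : 3 * Real.log x < T) (hT' : T < Real.sqrt x / 3)
    (hTH : ∀ n < N, FKS2023.zfrHeight R (FKS2023.sigmaStep σ₁ σ₂ N n) ≤ T)
    (hTt₀ : FKS2023.t₀ R σ₂ x ≤ T) :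
    |ψ x - x| ≤ (FKS2023.ε₁ x T + FKS2023.ε₂ 0.11200 0.12567 4.64917 x σ₁ T₀ S₀ T
      + FKS2023.ε₃ c₁ c₂ p q R x σ₁ σ₂ N T
      + FKS2023.ε₄ (c₁ σ₂) (c₂ σ₂) (p σ₂) (q σ₂) R x σ₂ K T) * x :=
  FioriKadiriSwidinsky2023_eq41' hCHJ hTab hRH (by linarith) (hBTY.zeroFree hR) (by norm_num)
    (by norm_num) (fun _ ht ↦ hBW.abs_count_sub_countMain_le_two' ht) hrow h58 h12 hσ₂ hpq hZD hN2
    hK hx hT hT' hTH hTt₀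

/-- **FKS (4.1) at `x`, explicit (ZDB) family, new inputs**: `0.90 ≤ σ₁ < σ₂ < 1`, the (ZDB) family
read off the Cor. 2.9 table fact (`FKS2023.table6c₁/c₂`, `p = 8(1−σ)/3`, `q = 5 − 2σ`), any
`R > 4.896` (Bellotti–Trudgian–Yang, claimed) and the Bellotti–Wong `N(T)` error
`(0.11200, 0.12567, 4.64917)`. Compare `FioriKadiriSwidinsky2023_eq41_explicit` (`R = 5.558691`,
Backlund triple `(0.3083, 0, 3.253)`, no claimed input).
[cite: FioriKadiriSwidinsky2023, §4 eq. (4.1) (proof of Thm. 1.1) with Cor. 2.9]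
[claim: BellottiTrudgianYang2026, status: under-review] [cite: BellottiWong2025, Thm. 1.1] -/
theorem FioriKadiriSwidinsky2023_eq41_explicit_bty_bw (hBTY : zero_free_region_bellotti_trudgian_yang)
    (hBW : BellottiWong2025_thm11) (hCHJ : CullyHugillJohnston2023_table4')
    (hTab : FioriKadiriSwidinsky2023_table2) (h6 : FioriKadiriSwidinsky2023_table6)
    (hRH : platt_trudgian_numerical_rh) {R : ℝ} (hR : 4.896 < R)
    {T₀ S₀ : ℝ} (hrow : (T₀, S₀) ∈ FKS2023.recipZeroTable2)
    {σ₁ σ₂ : ℝ} (h9 : 0.90 ≤ σ₁) (h12 : σ₁ < σ₂) (hσ₂ : σ₂ < 1)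
    {N K : ℕ} (hN2 : 2 ≤ N) (hK : 1 ≤ K) {x T : ℝ} (hx : Real.exp 50 < x)
    (hT : 3 * Real.log x < T) (hT' : T < Real.sqrt x / 3)
    (hTH : ∀ n < N, FKS2023.zfrHeight R (FKS2023.sigmaStep σ₁ σ₂ N n) ≤ T)
    (hTt₀ : FKS2023.t₀ R σ₂ x ≤ T) :
    |ψ x - x| ≤ (FKS2023.ε₁ x T + FKS2023.ε₂ 0.11200 0.12567 4.64917 x σ₁ T₀ S₀ T
      + FKS2023.ε₃ FKS2023.table6c₁ FKS2023.table6c₂ (fun σ ↦ 8 / 3 * (1 - σ)) (fun σ ↦ 5 - 2 * σ)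
          R x σ₁ σ₂ N T
      + FKS2023.ε₄ (FKS2023.table6c₁ σ₂) (FKS2023.table6c₂ σ₂) (8 / 3 * (1 - σ₂)) (5 - 2 * σ₂)
          R x σ₂ K T) * x := by
  have h9' : (5 : ℝ) / 8 ≤ σ₁ := by norm_num at h9; linarith
  exact FioriKadiriSwidinsky2023_eq41_of_bty_bw hBTY hBW hCHJ hTab hRH hR hrow
    (p := fun σ ↦ 8 / 3 * (1 - σ)) (q := fun σ ↦ 5 - 2 * σ) h9' h12 hσ₂.le
    (fun σ hσ ↦ zdb_exponents_of_lt_of_lt (by linarith [hσ.1]) (by linarith [hσ.2]))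
    (fun σ hσ T' hT' ↦ FKS2023.table6_zdbMajorant h6 (by linarith [hσ.1]) (by linarith [hσ.2]) hT')
    hN2 hK hx hT hT' hTH hTt₀

end Literature.NumberTheory.LFunctions

end
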